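import Literature.AlgebraicGeometry.Frobenioids.UnitTrivializationFunctoriality
import Mathlib.CategoryTheory.SingleObj
import HarnessLib

/-!
# Frobenioids I, Theorem 3.4 (iv): the hypothesis `PreservesUnitEquiv` — its universal closure is FALSE
# (schema negative; PROOF-ONLY companion of `UnitTrivializationFunctoriality.lean`)

Mochizuki, *The geometry of Frobenioids I: the general theory*, Kyushu J. Math. **62** (2008),
Definition 3.1 (iv) p. 57 (unit-equivalence `≈^{O^×}`), Theorem 3.4 (iv) p. 63
[cite: MochizukiFrdI2008, Thm. 3.4 (iv) p.63].

OURS (abc-iut cell, F wave seat f-050, FACT-LIST row F-1295; NOT a construction of the paper).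
`PreFrobenioidData.PreservesUnitEquiv S₁ S₂ Ψ` is a PARAMETRISED hypothesis predicate ("the functor `Ψ` on
`C^istr` carries unit-equivalent pairs to unit-equivalent pairs"); R5: its universal closure over all functors
`Ψ : C₁^istr ⥤ C₂^istr` is no fact. Kernel witness: over `C := B(ℤ × ℤ)` projecting to `D := Bℤ` by the first
coordinate (all operations trivial: `Φ ≡ 0`, `deg_Fr ≡ 1`), the units of the unique (isotropic) object are
`O^× = {0} × ℤ`, and the functor induced by the SWAP automorphism `(m, n) ↦ (n, m)` carries the unit `(0, 1)`
(`≈^{O^×}`-equivalent to the identity) to `(1, 0)`, which is not `≈^{O^×}`-equivalent to the identity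
(`not_preservesUnitEquiv_swap`, `not_forall_preservesUnitEquiv`). The instance forms that DO hold are in
`UnitTrivializationFunctorialityHolds.lean`. Nothing of the paper is contradicted (print asserts the property
only for `Ψ^istr` of an equivalence of Frobenioids preserving `O^×(-)`); nothing here bears on [IUTchIII].
-/

namespace Literature.AlgebraicGeometry.Frobenioids

namespace PreFrobenioidData

open CategoryTheory

namespace UnitEquivSwapWitness

/-- The automorphism group `ℤ × ℤ` of the unique object of `C`, written multiplicatively. [cite: MochizukiFrdI2008, Def. 3.1 (iv) p.57] -/
abbrev G : Type := Multiplicative (ℤ × ℤ)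

/-- `C := B(ℤ × ℤ)`. [cite: MochizukiFrdI2008, Def. 3.1 (iv) p.57] -/
abbrev C : Type := SingleObj G

/-- `D := Bℤ`. [cite: MochizukiFrdI2008, Def. 3.1 (iv) p.57] -/
abbrev D : Type := SingleObj (Multiplicative ℤ)

/-- The projection `C → D`, `(m, n) ↦ m`. [cite: MochizukiFrdI2008, Def. 1.1 (iv) p.20] -/
def base : C ⥤ D := SingleObj.mapHom G (Multiplicative ℤ) (AddMonoidHom.fst ℤ ℤ).toMultiplicative

/-- The pre-Frobenioid operations of the witness: base `(m, n) ↦ m`, trivial divisor monoid, all Frobenius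
degrees `1`. [cite: MochizukiFrdI2008, Def. 1.1 (iv) p.20] -/
def S : PreFrobenioidData.{0} C D where
  base := base
  Mon _ := PUnit
  pull _ := MonoidHom.id _
  pull_id _ _ := rfl
  pull_comp _ _ _ := rfl
  div _ := PUnit.unit
  degFr _ := 1
  div_id _ := rfl
  div_comp _ _ := rfl
  degFr_id _ := rfl
  degFr_comp _ _ := rfl

/-- Every object of the groupoid `C` is isotropic. [cite: MochizukiFrdI2008, Def. 1.2 (iv) p.23] -/
theorem isIsotropic (A : C) : S.IsIsotropic A := fun _ _ _ => inferInstance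

/-- The unique object of `C^istr`. [cite: MochizukiFrdI2008, Def. 3.1 (iv) p.57] -/
def X : S.Istr := ⟨SingleObj.star G, isIsotropic _⟩

/-- The swap `(m, n) ↦ (n, m)` as an endofunctor of `C`. [cite: MochizukiFrdI2008, Def. 3.1 (iv) p.57] -/
def swap : C ⥤ C := SingleObj.mapHom G G (AddEquiv.prodComm (M := ℤ) (N := ℤ)).toAddMonoidHom.toMultiplicative

/-- The swap on `C^istr`. [cite: MochizukiFrdI2008, Def. 3.1 (iv) p.57] -/
def Ψ : S.Istr ⥤ S.Istr := S.isotropicObjects.lift (S.istrι ⋙ swap) fun _ => isIsotropic _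

/-- The unit `(0, 1) ∈ O^×(∗)`. [cite: MochizukiFrdI2008, Def. 1.2 (ii) p.22] -/
def u : SingleObj.star G ⟶ SingleObj.star G := Multiplicative.ofAdd ((0, 1) : ℤ × ℤ)

/-- `(0, 1)` is a unit: base-identity and linear. [cite: MochizukiFrdI2008, Def. 1.2 (ii) p.22] -/
theorem u_mem : asIso u ∈ S.unitsSubgroup (SingleObj.star G) := ⟨rfl, rfl⟩

/-- `id ≈^{O^×} (0, 1)` in `C^istr`. [cite: MochizukiFrdI2008, Def. 3.1 (iv) p.57] -/
theorem unitEquiv_id_u : S.UnitEquiv (𝟙 X) (ObjectProperty.homMk (asIso u).hom : X ⟶ X) :=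
  ⟨X, 𝟙 X, 𝟙 X, asIso u, u_mem, (Category.id_comp _).symm, by simp⟩

/-- A pair `(id, φ)` is unit-equivalent only if `φ` is base-identity. [cite: MochizukiFrdI2008, Def. 3.1 (iv) p.57] -/
theorem isBaseIdentity_of_unitEquiv_id {Y : S.Istr} (φ : Y ⟶ Y) (h : S.UnitEquiv (𝟙 Y) φ) :
    S.IsBaseIdentity φ.hom := by
  obtain ⟨Y', γ, β, δ, hδ, h1, h2⟩ := h
  have h1' := (congrArg InducedCategory.Hom.hom h1).symm
  have h2' := congrArg InducedCategory.Hom.hom h2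
  change (show G from β.hom) * (show G from γ.hom) = 1 at h1'
  change (show G from φ.hom) = ((show G from β.hom) * (show G from δ.hom)) * (show G from γ.hom) at h2'
  have hφ : (show G from φ.hom) = (show G from δ.hom) := by
    rw [h2', mul_right_comm, h1', one_mul]
  exact (congrArg S.base.map hφ).trans hδ.1

/-- **The swap does NOT preserve unit-equivalence**: `Ψ(0,1) = (1,0)` is not base-identity.
[cite: MochizukiFrdI2008, Thm. 3.4 (iv) p.63] -/
theorem not_preservesUnitEquiv_swap : ¬ PreservesUnitEquiv S S Ψ := fun h => by
  have h1 := isBaseIdentity_of_unitEquiv_id _ (by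
    have h' := h _ _ unitEquiv_id_u
    rwa [CategoryTheory.Functor.map_id] at h')
  have h2 : Multiplicative.toAdd (S.base.map ((Ψ.map (ObjectProperty.homMk (asIso u).hom : X ⟶ X)).hom)) = 1 := rfl
  rw [h1] at h2
  exact zero_ne_one h2

end UnitEquivSwapWitness

/-- **The universal closure of `PreservesUnitEquiv` is false** (FACT-LIST row F-1295 is a schema: only its
instance forms — `UnitTrivializationFunctorialityHolds.lean` — are facts). [cite: MochizukiFrdI2008, Thm. 3.4 (iv) p.63] -/
theorem not_forall_preservesUnitEquiv :
    ¬ ∀ (C₁ : Type) [Category.{0} C₁] (D₁ : Type) [Category.{0} D₁] (C₂ : Type) [Category.{0} C₂] (D₂ : Type)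
      [Category.{0} D₂] (S₁ : PreFrobenioidData.{0} C₁ D₁) (S₂ : PreFrobenioidData.{0} C₂ D₂) (Ψ : S₁.Istr ⥤ S₂.Istr),
      Literature.AlgebraicGeometry.Frobenioids.PreFrobenioidData.PreservesUnitEquiv S₁ S₂ Ψ := fun h =>
  UnitEquivSwapWitness.not_preservesUnitEquiv_swap (h _ _ _ _ _ _ _)

end PreFrobenioidData

end Literature.AlgebraicGeometry.Frobenioids
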